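import Literature.Probability.Percolation.ArmSeparationProofs
import Literature.Probability.Percolation.ArmSeparationFinalProofs
import HarnessLib

/-!
# Quasi-multiplicativity of the critical two-arm probability (Nolin 2008, Prop. 17): the discharge

Topic: Probability / Percolation; family `crit-perc` (`P = P_{1/2} = triSitePercolation half`).
Theorems only (no definitions, no named facts). The named fact
`Literature.Probability.Percolation.Nolin2008_twoArm_quasiMult` (`ArmExponentsTwoArm.lean`;
Nolin 2008, Prop. 17 [arXiv 0711.4948: Prop. 16, p. 13], lower half, `j = 2`, `σ = BW`,
`p = 1/2`):

`∃ c > 0, ∃ n₀, ∀ n₀ ≤ n₁ < n₂ < n₃, c · b(n₁, n₂) · b(n₂, n₃) ≤ b(n₁, n₃)`,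
`b(n, N) = critTwoArmProb n N = P_{1/2}(armEvent ![true, false] n N)`,

now HOLDS: Nolin deduces it from his arm-separation theorem (Thm. 11 [arXiv Thm. 10]) and
extendability by RSW gluing — that deduction is the tree's
`Nolin2008_twoArm_quasiMult_of_separation` (`ArmSeparationProofs.lean`) — and the separation
theorem for two arms is the tree's `Nolin2008_twoArm_separation_holds`
(`ArmSeparationFinalProofs.lean`). Consequently Smirnov–Werner's two-arm exponent
(`twoArm_exponent`, MRL 2001, Thm. 4 for `j = 2`) is reduced to their scaling-limit input (A)
alone (`twoArm_exponent_of_scalingLimit`).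

## References

* P. Nolin, *Near-critical percolation in two dimensions*, Electron. J. Probab. 13 (2008),
  1562–1623, Prop. 17 and Thm. 11 [arXiv 0711.4948: Prop. 16 (p. 13), Thm. 10]. [Nolin2008]
* S. Smirnov, W. Werner, *Critical exponents for two-dimensional percolation*, Math. Res. Lett. 8
  (2001), 729–744, Thm. 4 and §4 (10). [SmirnovWernerMRL2001]
-/

namespace Literature.Probability.Percolation

/-- **Quasi-multiplicativity of the two-arm probability at `p = 1/2`** (Nolin 2008, Prop. 17
[arXiv 0711.4948: Prop. 16], lower half, `j = 2`, `σ = BW`): the named fact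
`Nolin2008_twoArm_quasiMult` holds — Nolin's deduction from arm separation
(`Nolin2008_twoArm_quasiMult_of_separation`) applied to the arm-separation theorem for two arms
(`Nolin2008_twoArm_separation_holds`). [cite: Nolin2008, Prop. 17 (arXiv 0711.4948: Prop. 16, p. 13) and Thm. 11 (arXiv Thm. 10)] -/
theorem Nolin2008_twoArm_quasiMult_holds : Nolin2008_twoArm_quasiMult :=
  Nolin2008_twoArm_quasiMult_of_separation Nolin2008_twoArm_separation_holds

/-- **The two-arm exponent from the scaling limit alone.** Smirnov–Werner's Thm. 4 for `j = 2`
(`twoArm_exponent`) follows from their scaling-limit input (A)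
(`SmirnovWerner2001_twoArm_scalingLimit`), the quasi-multiplicativity (B) of §4 (10) being now a
theorem (`Nolin2008_twoArm_quasiMult_holds`). [cite: SmirnovWernerMRL2001, Thm. 4 (j = 2) and §4 (10)] [cite: Nolin2008, Prop. 17 (arXiv 0711.4948: Prop. 16)] -/
theorem twoArm_exponent_of_scalingLimit (hA : SmirnovWerner2001_twoArm_scalingLimit) :
    twoArm_exponent :=
  twoArm_exponent_of_facts hA Nolin2008_twoArm_quasiMult_holds

end Literature.Probability.Percolation
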